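/-
Copyright (c) 2026 the pub-hodgecm-mathlib formalisation cell (harness21).  Prover seat hodgecm-mathlib-K2Liu-p01 (g11) (K1a desk), Track B «K2-LIT» ∕ hLiu418 #184♮,
socket #41, KIND 1 a♮ ∕ #42S BLOCK D row D-1 — THE «ARCH-CONT» LETTERS `Ac hAc hA` PRODUCED FROM THE PER-PLACE ARCHIMEDEAN ALPHABET `Tinf Aloc Acw hAcw hAw cA hAinf`
(★ p863921 `K2LiuIncoherentRankOneArchSplitOfFaces` ∕ ★ p864498 `K2LiuKindOneSingularArchDecayOfRecord` take BOTH by value; this file makes the first three a NAME over the rest).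
THEOREMS ONLY (no `def`, no `instance`, no notation, no named-fact hypothesis, no `sorry`, default heartbeats).
-/
import Summits.HodgeConjecture.HodgeConjecture.Theorems.K2LiuIncoherentRankOneArchSplitOfFaces   -- ★ p863921 (LH4-p17): the per-place arch alphabet's binder shapes + the frame vocabulary
import HarnessLib

/-!
# Crux `HLiu418`, socket #41 KIND 1 a♮ ∕ #42S BLOCK D row D-1 — `K2LiuKindOneSingularArchContOfPlaceLetters`: «ARCH-CONT» `Ac hAc hA` FROM THE PER-PLACE ARCH LETTERS

Cell `hodgecm-mathlib`, crux item hLiu418 = `stmt-HodgeConjecture-24832` (helper lane `--supports … --as helper`, count-neutral), route of record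
`HCCMUnconditional`; squad K2 ∕ K2Liu, road `K2_Liu`; K1a desk K2Liu-p01 (g11) (LEAD F0P6-plan (g15) BATCH #250 (2)); block-D desk K2Liu-p12 (g6).

THE SLOT.  The K1-a♮ block of record (★ p864546 `exists_kindOne_singularTerm_of_record₄`), its (L2-den) payer (★ p864498 `hAcb_of_archLetters`) and BLOCK D's row D-1 (★ p863921
`hsplit_faces_of_archLetters`, ★ p864094 `hdead_blockD_of_record`) ALL keep BY VALUE the «ARCH-CONT» letters of ★ p863404 §2 (ii): a holomorphic continuation `Ac X i · h` on
`{0 < re}` of the raw archimedean factor `A X i · h` of every pure tensor (`hAc`), agreeing with it on `{1 < re}` (`hA`).  The per-place archimedean alphabet of the D-arch line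
(LH4-p17 (g3): ★ p864260 `hAinf_of_frameTensor`, ★ p864594; (Φ-S1) R90-C131-p02: the continued LOCAL letters) already states, by value: the finite set `Tinf` of archimedean
places, the raw local letters `Aloc X i w · h`, their continuations `Acw X i w · h` holomorphic on `{0 < re}` (`hAcw`) and agreeing on `{½ < re}` (`hAw`), and the PLACE TENSOR
`A X i s h = cA X h i · ∏_{w∈Tinf} Aloc X i w s h` on `{1 < re}` (`hAinf`).  From these, the three «ARCH-CONT» letters are a DEFINITION AND TWO LINES:
`Ac X i s h := cA X h i · ∏_{w∈Tinf} Acw X i w s h` is holomorphic on `{0 < re}` (finite product) and equals `A X i s h` on `{1 < re}` (`hAinf`, then `hAw` factorwise since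
`1 < re s ⇒ ½ < re s`).  So the tie `obtain`s `Ac hAc hA` from the SAME six per-place tokens BLOCK D already carries, and ★ p863921's value split `Ac X i ½ h = cA·∏ Acw X i w ½ h`
(proved there by the identity theorem for an ARBITRARY continuation) holds for THIS `Ac` by `rfl` (exported as the third conjunct, all `s`).
* **`archCont_of_placeLetters`** — generic rank `n`, generic face index `φ`, faces `I X h`; binders = ★ p863921 `ac_eq_cA_mul_prod_of_archLetters`'s `(I) (A) (Tinf Aloc Acw hAcw hAw cA hAinf)`
  VERBATIM (its `Ac hAc hA` dropped) ⊢ `∃ Ac, hAc ∧ hA ∧ (∀ X h i s, Ac X i s h = cA X h i * ∏ w ∈ Tinf, Acw X i w s h)` with `hAc hA` in ★ p863404 §2 (ii)'s BYTES.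
[KudlaRallis1994, §2 (2.10)–(2.12)], [Shimura1982, §4 Thm. 4.2], [Shimura1997, §18.4], [Tan1999, §3].
HONEST LABEL.  Twenty lines of bookkeeping, count-neutral; it closes no socket by itself: `HC_CM` is proved only modulo the 7 printed citations (2 remaining named inputs:
hLiu418 = `stmt-HodgeConjecture-24832`, h413 = `stmt-HodgeConjecture-24833`) until rung 0 closes.  The per-place letters `Aloc Acw hAcw hAw cA hAinf` stay BY VALUE (payers:
★ p864260 ∕ ★ p864594 for `Aloc cA hAinf` at the carrier of record, the (Φ-S1) continuations for `Acw hAcw hAw`).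

## References
* [KudlaRallis1994] S. Kudla, S. Rallis, *A regularized Siegel–Weil formula: the first term identity*, Ann. of Math. 140 (1994): §2 (2.10)–(2.12).
* [Shimura1982] G. Shimura, *Confluent hypergeometric functions on tube domains*, Math. Ann. 260 (1982): §4 Thm. 4.2.
* [Shimura1997] G. Shimura, *Euler Products and Eisenstein Series*, CBMS 93 (1997): §18.4.   * [Tan1999] V. Tan, Canad. J. Math. 51 (1999): §3.
-/

set_option autoImplicit false
set_option linter.dupNamespace false -- the mandated namespace repeats `HodgeConjecture.HodgeConjecture`

noncomputable section

open scoped Matrix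
open NumberField NumberField.InfinitePlace IsDedekindDomain
open Literature.NumberTheory.Automorphic Literature.NumberTheory.Automorphic.UnitaryGroup Literature.NumberTheory.GaloisRepresentations
open Literature.NumberTheory.GelbartRogawski1991 Literature.NumberTheory.GelbartRogawski1991.GRConstruction

namespace Summit.HodgeConjecture.HodgeConjecture.Cruxes.HLiu418.K2LiuKindOneSingularArchContOfPlaceLetters

open K2LiuSiegelUnipotentFourierDefs

variable (L : Type) [Field L] [NumberField L] [IsCMField L]
variable {N M n : ℕ} (e : Fin N × Fin M ≃ Fin n)
  (dV : Fin N → L) (hdV : ∀ i, IsCMField.complexConj L (dV i) = dV i)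
  (dW : Fin M → L) (hdW : ∀ i, IsCMField.complexConj L (dW i) = dW i)

/-- **«ARCH-CONT» FROM THE PER-PLACE ARCH LETTERS.**  Per rank-one index `X`, point `h` and face `i ∈ I X h`: given the finite set `Tinf` of archimedean places, raw local letters
`Aloc`, their continuations `Acw` holomorphic on `{0 < re}` (`hAcw`) with `Aloc = Acw` on `{½ < re}` (`hAw`), and the place tensor `A X i s h = cA X h i · ∏_{w∈Tinf} Aloc X i w s h`
on `{1 < re}` (`hAinf`) — ★ p863921's binder BYTES —, THEN `∃ Ac` with ★ p863404 §2 (ii)'s `hAc` (holomorphic on `{0 < re}` per rank-one `X`, `h`, `i ∈ I X h`) and `hA`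
(`A X i s h = Ac X i s h` on `{1 < re}`), and the WITNESS `Ac X i s h = cA X h i · ∏_{w∈Tinf} Acw X i w s h` (all `X h i s`).
[cite: KudlaRallis1994, §2 (2.10)–(2.12)] [cite: Shimura1982, §4 Thm. 4.2] [cite: Shimura1997, §18.4] -/
theorem archCont_of_placeLetters {φ : Type*}
    (I : skewMatrices ((IsCMField.complexConj L : L ≃ₐ[Fp L] L) : L →+* L) ((gramR L e dV hdV dW hdW).map (algebraMap (Fp L) L)) → HA L e dV hdV dW hdW → Finset φ)
    (A : skewMatrices ((IsCMField.complexConj L : L ≃ₐ[Fp L] L) : L →+* L) ((gramR L e dV hdV dW hdW).map (algebraMap (Fp L) L)) → φ → ℂ → HA L e dV hdV dW hdW → ℂ)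
    -- the per-place arch letters (★ p863921's binders VERBATIM)
    (Tinf : Finset (InfinitePlace L))
    (Aloc : skewMatrices ((IsCMField.complexConj L : L ≃ₐ[Fp L] L) : L →+* L) ((gramR L e dV hdV dW hdW).map (algebraMap (Fp L) L)) → φ → InfinitePlace L → ℂ →
      HA L e dV hdV dW hdW → ℂ)
    (Acw : skewMatrices ((IsCMField.complexConj L : L ≃ₐ[Fp L] L) : L →+* L) ((gramR L e dV hdV dW hdW).map (algebraMap (Fp L) L)) → φ → InfinitePlace L → ℂ →
      HA L e dV hdV dW hdW → ℂ)
    (hAcw : ∀ X : skewMatrices ((IsCMField.complexConj L : L ≃ₐ[Fp L] L) : L →+* L) ((gramR L e dV hdV dW hdW).map (algebraMap (Fp L) L)),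
      (X : Matrix (Fin n) (Fin n) L) ≠ 0 → (X : Matrix (Fin n) (Fin n) L).det = 0 → ∀ (h : HA L e dV hdV dW hdW), ∀ i ∈ I X h, ∀ w ∈ Tinf,
        DifferentiableOn ℂ (fun s => Acw X i w s h) {s : ℂ | 0 < s.re})
    (hAw : ∀ X : skewMatrices ((IsCMField.complexConj L : L ≃ₐ[Fp L] L) : L →+* L) ((gramR L e dV hdV dW hdW).map (algebraMap (Fp L) L)),
      (X : Matrix (Fin n) (Fin n) L) ≠ 0 → (X : Matrix (Fin n) (Fin n) L).det = 0 → ∀ (h : HA L e dV hdV dW hdW), ∀ i ∈ I X h, ∀ w ∈ Tinf,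
        ∀ s : ℂ, 1 / 2 < s.re → Aloc X i w s h = Acw X i w s h)
    -- the place-tensor letter on the convergence half-plane, with its scalar `cA`
    (cA : skewMatrices ((IsCMField.complexConj L : L ≃ₐ[Fp L] L) : L →+* L) ((gramR L e dV hdV dW hdW).map (algebraMap (Fp L) L)) → HA L e dV hdV dW hdW → φ → ℂ)
    (hAinf : ∀ X : skewMatrices ((IsCMField.complexConj L : L ≃ₐ[Fp L] L) : L →+* L) ((gramR L e dV hdV dW hdW).map (algebraMap (Fp L) L)),
      (X : Matrix (Fin n) (Fin n) L) ≠ 0 → (X : Matrix (Fin n) (Fin n) L).det = 0 → ∀ (h : HA L e dV hdV dW hdW), ∀ i ∈ I X h,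
        ∀ s : ℂ, 1 < s.re → A X i s h = cA X h i * ∏ w ∈ Tinf, Aloc X i w s h) :
    ∃ Ac : skewMatrices ((IsCMField.complexConj L : L ≃ₐ[Fp L] L) : L →+* L) ((gramR L e dV hdV dW hdW).map (algebraMap (Fp L) L)) → φ → ℂ → HA L e dV hdV dW hdW → ℂ,
      (∀ X : skewMatrices ((IsCMField.complexConj L : L ≃ₐ[Fp L] L) : L →+* L) ((gramR L e dV hdV dW hdW).map (algebraMap (Fp L) L)),
        (X : Matrix (Fin n) (Fin n) L) ≠ 0 → (X : Matrix (Fin n) (Fin n) L).det = 0 → ∀ (h : HA L e dV hdV dW hdW), ∀ i ∈ I X h,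
          DifferentiableOn ℂ (fun s => Ac X i s h) {s : ℂ | 0 < s.re}) ∧
      (∀ X : skewMatrices ((IsCMField.complexConj L : L ≃ₐ[Fp L] L) : L →+* L) ((gramR L e dV hdV dW hdW).map (algebraMap (Fp L) L)),
        (X : Matrix (Fin n) (Fin n) L) ≠ 0 → (X : Matrix (Fin n) (Fin n) L).det = 0 → ∀ (h : HA L e dV hdV dW hdW), ∀ i ∈ I X h,
          ∀ s : ℂ, 1 < s.re → A X i s h = Ac X i s h) ∧
      (∀ (X : skewMatrices ((IsCMField.complexConj L : L ≃ₐ[Fp L] L) : L →+* L) ((gramR L e dV hdV dW hdW).map (algebraMap (Fp L) L))) (h : HA L e dV hdV dW hdW) (i : φ) (s : ℂ),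
        Ac X i s h = cA X h i * ∏ w ∈ Tinf, Acw X i w s h) := by
  refine ⟨fun X i s h => cA X h i * ∏ w ∈ Tinf, Acw X i w s h, fun X hX0 hXd h i hi => ?_, fun X hX0 hXd h i hi s hs => ?_, fun _ _ _ _ => rfl⟩
  · -- `hAc`: a constant times a finite product of holomorphic local continuations
    exact (differentiableOn_const (cA X h i)).mul (DifferentiableOn.fun_finsetProd fun w hw => hAcw X hX0 hXd h i hi w hw)
  · -- `hA`: the place tensor on `{1 < re}`, then the local agreements (`1 < re s ⇒ ½ < re s`)
    have hs' : 1 / 2 < s.re := by linarith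
    rw [hAinf X hX0 hXd h i hi s hs]
    exact congrArg _ (Finset.prod_congr rfl fun w hw => hAw X hX0 hXd h i hi w hw s hs')

end Summit.HodgeConjecture.HodgeConjecture.Cruxes.HLiu418.K2LiuKindOneSingularArchContOfPlaceLetters

end
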